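import Summits.RiemannHypothesis.RiemannHypothesis.Theorems.EtaLeadingQuarterSecondMomentEngineZones
import Summits.RiemannHypothesis.RiemannHypothesis.Theorems.EtaLeadingQuarterSecondMomentAlt
import Literature.NumberTheory.LFunctions.ZetaSpacingDensityRH
import Literature.NumberTheory.LFunctions.MontgomeryZeroWindows
import Literature.NumberTheory.Sieve.MatomakiRadziwillLemma11Tools
import HarnessLib

/-!
# The sharp eta vector at the zeros — engine V: the per-zero AFE engine
(route EtaLeadingQuarter, item `EtaLeadingSecondMoment`, stmt-RiemannHypothesis-21791)

`engine` is VERBATIM the hypothesis `hEng` of `Zeros.even_bound_of_engine` (the `ε`-closer of the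
item along the even `M`): under RH there are `q ≥ 0` and for every `η ∈ (0, 1/2]` a `c ≥ 0` with,
for all large even `M = 2L` and every `n` with `4⌊M/2⌋ < γ_n ≤ M²`,

  `‖T_M(1/2+iγ_n)‖ ≤ √2 ‖S(⌊γ_n/(πM)⌋, γ_n)‖ + (c (1+log M)/√M + 1_{d_n ≤ η} q √(M/γ_n))`,

`T_M(s) = ∑_{m≤M} (−1)^m m^{−s}`, `S(y,t) = ∑_{k odd ≤ y} k^{−1/2} k^{−it}`, `d_n = |γ_n/(πM) − round(γ_n/(πM))|`;
here `q = 400`, `c = 400 + 12/η`. Proof: RH puts the zero at `s = 1/2 + iγ_n`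
(`BGMM2023.riemannZeta_half_add_zetaOrdinate`); the duality at a zero
`‖T_{2L}(s)‖ ≤ √2 ‖∑_{odd ν ≤ [γ/(2πL)]} ν^{s−1}‖ + √2 ‖Q_L(s)‖ + ‖Q_{2L}(s)‖`
(`SecondMomentAFE.norm_altSum_le_of_zero`); the odd dual sum has the norm of `S` (complex
conjugate); and `Engine.norm_E_le` (parts I–IV) bounds the truncation errors by zone.
Nothing here bears on the truth of RH.
-/

noncomputable section

open Real Finset Filter Complex

set_option linter.dupNamespace false  -- the mandated namespace repeats `RiemannHypothesis`

namespace Summit.RiemannHypothesis.RiemannHypothesis.Theorems.EtaLeadingQuarter.Engine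

open Literature.NumberTheory.LFunctions Literature.NumberTheory.LFunctions.AFE
  Literature.NumberTheory.Sieve.MatomakiRadziwillL11

/-! ## The odd dual sum and the statement's `S` have the same norm -/

/-- `‖∑_{k∈F} k^{−1/2} k^{−it}‖ = ‖∑_{k∈F} k^{s−1}‖` for `s = 1/2 + it` (`F ⊆ ℕ_{≥1}`): the two sums
are complex conjugates. [folklore] -/
theorem norm_oddSum_eq (F : Finset ℕ) (hF : ∀ k ∈ F, 1 ≤ k) (t : ℝ) (s : ℂ)
    (hs : s = 1 / 2 + t * I) :
    ‖∑ k ∈ F, (((1 / Real.sqrt k : ℝ)) : ℂ) * (k : ℂ) ^ (-((t : ℂ) * I))‖ =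
      ‖∑ k ∈ F, (k : ℂ) ^ (s - 1)‖ := by
  rw [← Complex.norm_conj (∑ k ∈ F, (k : ℂ) ^ (s - 1)), map_sum]
  congr 1
  refine Finset.sum_congr rfl fun k hk ↦ ?_
  have hk1 := hF k hk
  have hk0 : (0 : ℝ) < k := by exact_mod_cast hk1
  have hkC : (k : ℂ) ≠ 0 := by exact_mod_cast (show k ≠ 0 by omega)
  have e1 : s - 1 = (((-(1 / 2 : ℝ)) : ℝ) : ℂ) + (t : ℂ) * I := by rw [hs]; push_cast; ring
  have hconj : (starRingEnd ℂ) (s - 1) = (((-(1 / 2 : ℝ)) : ℝ) : ℂ) + -((t : ℂ) * I) := by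
    rw [e1, map_add, map_mul, Complex.conj_ofReal, Complex.conj_ofReal, Complex.conj_I]; ring
  rw [conj_natCast_cpow, hconj, Complex.cpow_add _ _ hkC]
  congr 1
  rw [show (k : ℂ) = ((k : ℝ) : ℂ) by push_cast; rfl, ← Complex.ofReal_cpow hk0.le,
    Real.rpow_neg hk0.le, ← Real.sqrt_eq_rpow, one_div]

/-! ## The engine -/

/-- **The per-zero AFE engine of `EtaLeadingSecondMoment`** (hypothesis `hEng` of
`Zeros.even_bound_of_engine`, verbatim), with `q = 400` and `c = 400 + 12/η`. [folklore] -/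
theorem engine (hRH : RiemannHypothesis) :
    ∃ q : ℝ, 0 ≤ q ∧ ∀ η : ℝ, 0 < η → η ≤ 1 / 2 → ∃ c : ℝ, 0 ≤ c ∧
      ∀ᶠ M : ℕ in Filter.atTop, Even M →
        ∀ n ∈ Finset.Ico (zetaZeroCount (4 * ((M / 2 : ℕ) : ℝ))) (zetaZeroCount ((M : ℝ) ^ 2)),
          ‖∑ m ∈ Finset.Icc 1 M, (-1 : ℂ) ^ m * (m : ℂ) ^ (-((1 / 2 : ℂ) + (zetaOrdinate n : ℂ) * I))‖ ≤
            Real.sqrt 2 * ‖∑ k ∈ (Finset.Icc 1 ⌊zetaOrdinate n / (π * M)⌋₊).filter Odd,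
                (((1 / Real.sqrt k : ℝ)) : ℂ) * (k : ℂ) ^ (-((zetaOrdinate n : ℂ) * I))‖ +
              (c * (1 + Real.log M) / Real.sqrt M +
                (if |zetaOrdinate n / (π * M) - round (zetaOrdinate n / (π * M))| ≤ η then
                  q * Real.sqrt (M / zetaOrdinate n) else 0)) := by
  refine ⟨400, by norm_num, fun η hη0 hη2 ↦ ⟨400 + 12 / η, by positivity, ?_⟩⟩
  filter_upwards [eventually_ge_atTop 64] with M hM hEven n hn
  -- `M = 2L`
  obtain ⟨L, hL⟩ : ∃ L, M = 2 * L := ⟨M / 2, (Nat.two_mul_div_two_of_even hEven).symm⟩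
  subst hL
  have hL32 : 32 ≤ L := by omega
  have hL0 : (0 : ℝ) < L := by exact_mod_cast (show 0 < L by omega)
  rw [show 2 * L / 2 = L by omega] at hn
  rw [Finset.mem_Ico] at hn
  -- the height `t = γ_n ∈ (4L, M²]`
  set t : ℝ := zetaOrdinate n with htdef
  have htlo : 4 * (L : ℝ) < t := Montgomery.lt_zetaOrdinate_iff.2 hn.1
  have hthi : t ≤ ((2 * L : ℕ) : ℝ) ^ 2 := Montgomery.zetaOrdinate_le_iff_lt.2 hn.2
  have ht : 0 < t := by linarith
  -- the zero `s = 1/2 + it`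
  set s : ℂ := 1 / 2 + (t : ℂ) * I with hs
  have hζ : riemannZeta s = 0 := BGMM2023.riemannZeta_half_add_zetaOrdinate hRH n
  -- duality at the zero
  have hdual := SecondMomentAFE.norm_altSum_le_of_zero L s hs hζ
  -- the odd dual sum is the statement's `S`
  have hu : t / (π * ((2 * L : ℕ) : ℝ)) = t / (2 * π * L) := by push_cast; ring
  have hS : ‖∑ k ∈ (Finset.Icc 1 ⌊t / (2 * π * L)⌋₊).filter Odd,
        (((1 / Real.sqrt k : ℝ)) : ℂ) * (k : ℂ) ^ (-((t : ℂ) * I))‖ =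
      ‖∑ ν ∈ (Finset.Icc 1 ⌊t / (2 * π * L)⌋₊).filter (fun ν => Odd ν), (ν : ℂ) ^ (s - 1)‖ :=
    norm_oddSum_eq _ (fun k hk ↦ (Finset.mem_Icc.1 (Finset.mem_filter.1 hk).1).1) t s hs
  -- the truncation errors by zone
  have hE := norm_E_le hL32 htlo hthi hη0 hη2 s hs
  rw [hu, hS]
  linarith [hdual, hE]

end Summit.RiemannHypothesis.RiemannHypothesis.Theorems.EtaLeadingQuarter.Engine

end
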